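import Literature.NumberTheory.EllipticCurves.PastenValuationProduct
import Literature.NumberTheory.EllipticCurves.KodairaNeronLeFourProofs
import Literature.NumberTheory.EllipticCurves.NeronComponentIndexSplitProofs
import Literature.NumberTheory.EllipticCurves.TamagawaSubgroupProofs
import Literature.NumberTheory.DiophantineGeometry.LocalReductionProofs
import Literature.NumberTheory.DiophantineGeometry.MinimalDiscriminantProofs
import Literature.NumberTheory.DiophantineGeometry.MinimalDiscriminantFiniteProofs
import Literature.NumberTheory.DiophantineGeometry.MinimalDiscriminantFactorizationProofs
import Literature.NumberTheory.DiophantineGeometry.MinimalDiscriminantRingOfIntegersProofs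
import Literature.NumberTheory.DiophantineGeometry.ConductorRadicalProofs
import Literature.NumberTheory.DiophantineGeometry.AbcValuationProduct
import Literature.NumberTheory.DiophantineGeometry.PastenValuationProductsProofs
import Literature.NumberTheory.EllipticCurves.PastenValuationProductSemistableProofs
import HarnessLib

/-!
# Pasten's Tamagawa bound from the product of valuations (proofs)

Topic `NumberTheory/EllipticCurves`; namespace `Literature.NumberTheory.EllipticCurves`.
A *proofs* sibling (theorems only; no definitions, no named facts) of
`Literature.NumberTheory.EllipticCurves.PastenValuationProduct` — the Tamagawa side (Thm 1.15).
(First landed at `PastenValuationProductProofs.lean` as ledger p41105; that shared path was later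
overwritten by whole-file submissions of other units and now only indexes the per-topic siblings,
so the theorems are re-landed here verbatim.)

H. Pasten, *Shimura curves and the abc conjecture*, J. Number Theory 254 (2024) 214–335 =
arXiv:1705.09251 (held as `paper-arxiv-1705.09251`; numbering of the arXiv version). The semistable
clause of Theorem 1.15 (tree fact `pasten_thm_1_15_semistable`: `Tam(E) < K_ε · N_E^{11/2+ε}` for
every semi-stable `E/ℚ`) is, in print, the last sentence of Theorem 16.5 ("Furthermore, similar
estimates hold for `Tam(E)` instead of `∏_{p∣N_E} v_p(Δ_E)`", p. 50 of the arXiv version), and the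
printed argument is the one of Corollary 16.3 (loc. cit.):

> "if `E` has additive or non-split multiplicative reduction at a prime `p` then `Tam_p(E) ≤ 4`,
> so `Tam(E) ≤ 4^{ω(N_E)} ∏_{p ∣ N_E^*} v_p(Δ_E) ≪_ε N_E^ε ∏_{p ∣ N_E^*} v_p(Δ_E)`"

(with `Tam_p(E) = v_p(Δ_E)` at the primes of split multiplicative reduction, Kodaira–Néron),
followed by the first part of Theorem 16.5 (= Theorem 1.12, tree fact `pasten_thm_1_12`).

This file formalizes exactly this reduction:

* `localTamagawaNumber_le_max_four_ordMinimalDiscriminant` — `c_v ≤ max(4, ord_v Δ_min)` at every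
  finite place (Kodaira–Néron: the tree's discharged
  `WeierstrassCurve.index_goodReductionSubgroup_le_four_holds` and
  `localTamagawaNumber_eq_ordMinimalDiscriminant_of_hasSplitMultiplicativeReductionAt`);
* `tamagawaProduct_le_prod_primeFactors` and `tamagawaProduct_le_four_pow_mul_prod` —
  `Tam(E) ≤ ∏_{p ∣ Δ_E} max(4, v_p(Δ_E)) ≤ 4^{ω(N_E)} ∏_{p ∣ N_E} v_p(Δ_E)` for every `E/ℚ`;
* `exists_four_pow_card_primeFactors_le` — `4^{ω(n)} ≪_δ n^δ`;
* `pasten_thm_1_15_semistable_of_thm_1_12` — Theorem 1.12 (first clause) implies the semistable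
  clause of Theorem 1.15;
* `pasten_thm_1_15_semistable_of_valuationProduct_semistable`,
  `pasten_thm_1_15_semistable_of_pastenShimura2024_thm_1_12`,
  `pasten_thm_1_15_semistable_of_cor_16_2` — the same reduction from each of the tree's other
  spellings of the missing input: the first display of Theorem 1.12 alone
  (`DiophantineGeometry.pasten_valuationProduct_semistable`, the weakest hypothesis used here;
  `DiophantineGeometry.pastenShimura2024_thm_1_12`, semistable as `Squarefree N_E`), and the two
  inputs of its printed proof, Corollary 16.2 with `S = ∅` plus Mestre–Oesterlé for prime
  conductor (`pasten_cor_16_2`, `mestreOesterle_factorization_le_five`, through the tree's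
  `pasten_valuationProduct_semistable_of_cor_16_2`).

The remaining input, Theorem 1.12 = Theorem 16.5 itself (Shimura-curve parametrisations,
Jacquet–Langlands, the Ribet–Takahashi formula, modularity), is undischarged in every spelling
(`pasten_thm_1_12`, `DiophantineGeometry.pasten_valuationProduct_semistable`,
`DiophantineGeometry.pastenShimura2024_thm_1_12`; likewise `pasten_cor_16_2`); accordingly the
discharge `pasten_thm_1_15_semistable_holds` is NOT in this file — it is the one-liner
`pasten_thm_1_15_semistable_of_valuationProduct_semistable <discharge>` once any of them lands.

## References

* [PastenShimura2024] H. Pasten, *Shimura curves and the abc conjecture*, J. Number Theory 254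
  (2024) 214–335, doi:10.1016/j.jnt.2023.07.002, arXiv:1705.09251 — Thm 1.15, Cor 16.3, Thm 16.5.
* [SilvermanATAEC1994] J. H. Silverman, *Advanced Topics in the Arithmetic of Elliptic Curves*,
  GTM 151, Cor. IV.9.2(d) (Kodaira–Néron).
-/

noncomputable section

open scoped Classical

open IsDedekindDomain NumberField

namespace Literature.NumberTheory.EllipticCurves

section Local

variable {A : Type*} [CommRing A] [IsDedekindDomain A] {K : Type*} [Field K] [Algebra A K]
  [IsFractionRing A K] (v : HeightOneSpectrum A) (W : WeierstrassCurve K)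

/-- **Local Tamagawa numbers are at most `max(4, ord_v Δ_min)`** (Kodaira–Néron; Silverman,
*ATAEC* Cor. IV.9.2(d): `E(K)/E₀(K)` is cyclic of order `v(Δ)` for split multiplicative reduction
and has order `≤ 4` otherwise; this is the local input "`Tam_p(E) ≤ 4` if additive or non-split
multiplicative" of [PastenShimura2024, proof of Cor. 16.3]). For an elliptic curve `W` over the
fraction field `K` of a Dedekind domain and a finite place `v` with perfect residue field, the local
factor `c_v = [E(K_v) : E₀(K_v)]` of `WeierstrassCurve.tamagawaProduct` satisfies
`c_v ≤ max 4 (ord_v Δ_min)`. From the tree's discharged Kodaira–Néron theorems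
`WeierstrassCurve.index_goodReductionSubgroup_le_four_holds` (not split multiplicative) and
`localTamagawaNumber_eq_ordMinimalDiscriminant_of_hasSplitMultiplicativeReductionAt` (split).
[cite: SilvermanATAEC1994, Cor. IV.9.2(d) (PDF p. 340)] -/
theorem localTamagawaNumber_le_max_four_ordMinimalDiscriminant [W.IsElliptic]
    [PerfectField (IsLocalRing.ResidueField (v.adicCompletionIntegers K))] :
    (W.baseChange (v.adicCompletion K)).localTamagawaNumber (v.adicCompletionIntegers K) ≤
      max 4 (W.ordMinimalDiscriminant v) := by
  by_cases hs : W.HasSplitMultiplicativeReductionAt v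
  · rw [localTamagawaNumber_eq_ordMinimalDiscriminant_of_hasSplitMultiplicativeReductionAt v W hs]
    exact le_max_right _ _
  · haveI := W.isElliptic_localMinimalModel v
    change ((W.localMinimalModel v).goodReductionSubgroup (v.adicCompletionIntegers K)).index ≤ _
    exact ((W.localMinimalModel v).index_goodReductionSubgroup_le_four_holds
      (v.adicCompletionIntegers K) hs).2.trans (le_max_left _ _)

end Local

section NumberField

variable {K : Type*} [Field K] [NumberField K] (W : WeierstrassCurve K) [W.IsElliptic]
  (v : HeightOneSpectrum (𝓞 K))

/-- `c_v = 1` at a place with `ord_v Δ_min = 0` (i.e. of good reduction: Silverman, *AEC*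
VII.5.1(a) and the remark after VII.2.1; the tree's discharged
`WeierstrassCurve.ordMinimalDiscriminant_eq_zero_iff_holds` and
`WeierstrassCurve.localTamagawaNumber_eq_one_of_hasGoodReductionAt_holds`). [folklore] -/
theorem localTamagawaNumber_eq_one_of_ordMinimalDiscriminant_eq_zero
    (h : W.ordMinimalDiscriminant v = 0) :
    (W.baseChange (v.adicCompletion K)).localTamagawaNumber (v.adicCompletionIntegers K) = 1 :=
  W.localTamagawaNumber_eq_one_of_hasGoodReductionAt_holds v
    ((WeierstrassCurve.ordMinimalDiscriminant_eq_zero_iff_holds v W).mp h)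

end NumberField

section Rat

open Rat.HeightOneSpectrum

variable (W : WeierstrassCurve ℚ)

/-- `ord_v Δ_min` depends only on the rational prime below `v`: for places `v`, `v'` of two
integer rings `R`, `R'` of `ℚ` (e.g. `𝓞 ℚ` and `ℤ`) above the same prime, the exponents agree —
both are the exponent computed in `ℚ_p` (`WeierstrassCurve.ordMinimalDiscriminant_eq_padic`).
[folklore] -/
theorem ordMinimalDiscriminant_eq_of_primesEquiv_eq
    {R : Type*} [CommRing R] [IsDedekindDomain R] [Algebra R ℚ] [IsFractionRing R ℚ]
    [IsIntegralClosure R ℤ ℚ]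
    {R' : Type*} [CommRing R'] [IsDedekindDomain R'] [Algebra R' ℚ] [IsFractionRing R' ℚ]
    [IsIntegralClosure R' ℤ ℚ]
    (v : HeightOneSpectrum R) (v' : HeightOneSpectrum R') (h : primesEquiv v = primesEquiv v') :
    W.ordMinimalDiscriminant v = W.ordMinimalDiscriminant v' := by
  let e : Nat.Primes → ℕ := fun p =>
    haveI : Fact p.1.Prime := ⟨p.2⟩
    (IsDiscreteValuationRing.addVal ℤ_[p]
      (((W.baseChange ℚ_[p]).minimal ℤ_[p]).integralModel ℤ_[p]).Δ).toNat
  have h1 : W.ordMinimalDiscriminant v = e (primesEquiv v) := W.ordMinimalDiscriminant_eq_padic v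
  have h2 : W.ordMinimalDiscriminant v' = e (primesEquiv v') :=
    W.ordMinimalDiscriminant_eq_padic v'
  rw [h1, h2, h]

/-- Over `ℚ`: the exponent `ord_v Δ_min` at a place `v` of `𝓞 ℚ` is the exponent of the prime
`p_v = Rat.HeightOneSpectrum.natGenerator v` in `|Δ_min| = W.minimalDiscriminantNorm ℤ`
(Silverman, *AEC* VIII.8, definition of the minimal discriminant; the tree's
`WeierstrassCurve.factorization_minimalDiscriminantNorm_holds` over `ℤ`, transported to `𝓞 ℚ` by
`ordMinimalDiscriminant_eq_of_primesEquiv_eq`). [folklore] -/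
theorem ordMinimalDiscriminant_ringOfIntegers_eq_factorization (v : HeightOneSpectrum (𝓞 ℚ)) :
    W.ordMinimalDiscriminant v =
      (W.minimalDiscriminantNorm ℤ).factorization (natGenerator v) := by
  set vZ : HeightOneSpectrum ℤ := (primesEquiv (R := ℤ)).symm (primesEquiv v) with hvZ
  have hp : primesEquiv vZ = primesEquiv v := Equiv.apply_symm_apply _ _
  have hgen : natGenerator vZ = natGenerator v := congrArg Subtype.val hp
  rw [← hgen, W.factorization_minimalDiscriminantNorm_holds vZ]
  exact ordMinimalDiscriminant_eq_of_primesEquiv_eq W v vZ hp.symm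

variable [W.IsElliptic]

/-- **`Tam(E) ≤ ∏_{p ∣ Δ_E} max(4, v_p(Δ_E))`** for every elliptic curve `E/ℚ` (the local
analysis of [PastenShimura2024, proof of Cor. 16.3]: `Tam_p(E) ≤ 4` unless the reduction is split
multiplicative, in which case `Tam_p(E) = v_p(Δ_E)`; `Tam_p(E) = 1` at the good primes). Here
`Tam(E) = W.tamagawaProduct` (a `finprod` over the places of `𝓞 ℚ`, a genuine finite product over
the bad places) and `v_p(Δ_E) = (W.minimalDiscriminantNorm ℤ).factorization p`.
[cite: PastenShimura2024, proof of Corollary 16.3] -/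
theorem tamagawaProduct_le_prod_primeFactors :
    W.tamagawaProduct ≤ ∏ p ∈ (W.minimalDiscriminantNorm ℤ).primeFactors,
      max 4 ((W.minimalDiscriminantNorm ℤ).factorization p) := by
  have hfin : {v : HeightOneSpectrum (𝓞 ℚ) | W.ordMinimalDiscriminant v ≠ 0}.Finite :=
    W.finite_setOf_ordMinimalDiscriminant_ne_zero_holds (A := 𝓞 ℚ)
  have hsub : (Function.mulSupport fun v : HeightOneSpectrum (𝓞 ℚ) =>
      (W.baseChange (v.adicCompletion ℚ)).localTamagawaNumber (v.adicCompletionIntegers ℚ)) ⊆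
        hfin.toFinset := by
    intro v hv
    rw [Set.Finite.coe_toFinset, Set.mem_setOf_eq]
    exact fun h0 => hv (localTamagawaNumber_eq_one_of_ordMinimalDiscriminant_eq_zero W v h0)
  have htam : W.tamagawaProduct = ∏ v ∈ hfin.toFinset,
      (W.baseChange (v.adicCompletion ℚ)).localTamagawaNumber (v.adicCompletionIntegers ℚ) :=
    finprod_eq_prod_of_mulSupport_subset _ hsub
  have hinj : ∀ x ∈ hfin.toFinset, ∀ y ∈ hfin.toFinset,
      natGenerator x = natGenerator y → x = y :=
    fun x _ y _ h => (primesEquiv (R := 𝓞 ℚ)).injective (Subtype.ext h)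
  calc W.tamagawaProduct
      = ∏ v ∈ hfin.toFinset, (W.baseChange (v.adicCompletion ℚ)).localTamagawaNumber
          (v.adicCompletionIntegers ℚ) := htam
    _ ≤ ∏ v ∈ hfin.toFinset,
          max 4 ((W.minimalDiscriminantNorm ℤ).factorization (natGenerator v)) :=
        Finset.prod_le_prod' fun v _ =>
          (ordMinimalDiscriminant_ringOfIntegers_eq_factorization W v) ▸
            localTamagawaNumber_le_max_four_ordMinimalDiscriminant v W
    _ = ∏ p ∈ hfin.toFinset.image natGenerator,
          max 4 ((W.minimalDiscriminantNorm ℤ).factorization p) :=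
        (Finset.prod_image
          (f := fun p : ℕ => max 4 ((W.minimalDiscriminantNorm ℤ).factorization p)) hinj).symm
    _ ≤ ∏ p ∈ (W.minimalDiscriminantNorm ℤ).primeFactors,
          max 4 ((W.minimalDiscriminantNorm ℤ).factorization p) := by
        refine Finset.prod_le_prod_of_subset_of_one_le' (fun p hp => ?_)
          fun p _ _ => le_max_of_le_left (by norm_num)
        rw [Finset.mem_image] at hp
        obtain ⟨v, hv, rfl⟩ := hp
        rw [Set.Finite.mem_toFinset, Set.mem_setOf_eq,
          ordMinimalDiscriminant_ringOfIntegers_eq_factorization W v] at hv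
        rw [← Nat.support_factorization]
        exact Finsupp.mem_support_iff.mpr hv

/-- The conductor and the minimal discriminant of an elliptic curve over `ℚ` have the same prime
factors (the bad primes; Silverman, *AEC* VIII.11 with VII.5.1(a); the tree's discharged
`WeierstrassCurve.radical_conductorNorm_eq_holds`). [folklore] -/
theorem primeFactors_conductorNorm_eq :
    (W.conductorNorm ℤ).primeFactors = (W.minimalDiscriminantNorm ℤ).primeFactors := by
  have h : UniqueFactorizationMonoid.radical (W.conductorNorm ℤ) =
      UniqueFactorizationMonoid.radical (W.minimalDiscriminantNorm ℤ) :=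
    W.radical_conductorNorm_eq_holds
  rw [← Nat.primeFactors_radical, h, Nat.primeFactors_radical]

/-- **`Tam(E) ≤ 4^{ω(N_E)} ∏_{p ∣ N_E} v_p(Δ_E)`** for every elliptic curve `E/ℚ` — the displayed
inequality of [PastenShimura2024, proof of Cor. 16.3] (there with `N_E^*`, the product of the
multiplicative primes; over all of `N_E` the bound is the same argument since `v_p(Δ_E) ≥ 1` at
every bad prime): `max(4, v_p(Δ_E)) ≤ 4 · v_p(Δ_E)` for `p ∣ N_E`, and `N_E`, `Δ_E` have the same
prime factors. [cite: PastenShimura2024, proof of Corollary 16.3] -/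
theorem tamagawaProduct_le_four_pow_mul_prod :
    W.tamagawaProduct ≤ 4 ^ (W.conductorNorm ℤ).primeFactors.card *
      ∏ p ∈ (W.conductorNorm ℤ).primeFactors, (W.minimalDiscriminantNorm ℤ).factorization p := by
  rw [primeFactors_conductorNorm_eq W, ← Finset.prod_const, ← Finset.prod_mul_distrib]
  refine (tamagawaProduct_le_prod_primeFactors W).trans (Finset.prod_le_prod' fun p hp => ?_)
  have h1 : (W.minimalDiscriminantNorm ℤ).factorization p ≠ 0 := by
    rw [← Nat.support_factorization] at hp
    exact Finsupp.mem_support_iff.mp hp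
  exact max_le (by omega) (by omega)

/-- **`4^{ω(n)} ≪_δ n^δ`**: for every `δ > 0` there is `C > 0` with `4^{ω(n)} ≤ C · n^δ` for all
`n ≥ 1` (from the tree's `exists_two_pow_card_primeFactors_le`: `2^{ω(n)} ≤ C (∏_{p∣n} p)^{δ/2}`,
squared, and `∏_{p ∣ n} p ≤ n`). This is the "`4^{ω(N_E)} ≪_ε N_E^ε`" of
[PastenShimura2024, proof of Cor. 16.3]. [folklore] -/
theorem exists_four_pow_card_primeFactors_le (δ : ℝ) (hδ : 0 < δ) :
    ∃ C : ℝ, 0 < C ∧ ∀ n : ℕ, n ≠ 0 → (4 : ℝ) ^ n.primeFactors.card ≤ C * (n : ℝ) ^ δ := by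
  obtain ⟨C, hC, h⟩ :=
    DiophantineGeometry.exists_two_pow_card_primeFactors_le (δ / 2) (half_pos hδ)
  refine ⟨C ^ 2, by positivity, fun n hn => ?_⟩
  have h0 : (0 : ℝ) ≤ ∏ p ∈ n.primeFactors, (p : ℝ) := by positivity
  have hrad : (∏ p ∈ n.primeFactors, (p : ℝ)) ≤ n := by
    rw [← Nat.cast_prod, Nat.cast_le]
    exact Nat.le_of_dvd (Nat.pos_of_ne_zero hn) (Nat.prod_primeFactors_dvd n)
  have h2 : (0 : ℝ) ≤ (2 : ℝ) ^ n.primeFactors.card := by positivity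
  calc (4 : ℝ) ^ n.primeFactors.card = ((2 : ℝ) ^ n.primeFactors.card) ^ 2 := by
        rw [← pow_mul, pow_mul']; norm_num
    _ ≤ (C * (∏ p ∈ n.primeFactors, (p : ℝ)) ^ (δ / 2)) ^ 2 :=
        pow_le_pow_left₀ h2 (h n) 2
    _ = C ^ 2 * (∏ p ∈ n.primeFactors, (p : ℝ)) ^ δ := by
        rw [mul_pow, ← Real.rpow_natCast ((∏ p ∈ n.primeFactors, (p : ℝ)) ^ (δ / 2)),
          ← Real.rpow_mul h0]
        norm_num
    _ ≤ C ^ 2 * (n : ℝ) ^ δ := by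
        gcongr

/-- **Theorem 1.12 ⟹ Theorem 1.15, semistable clause** ([PastenShimura2024, Thm. 16.5, last
sentence]: "similar estimates hold for `Tam(E)` instead of `∏_{p∣N_E} v_p(Δ_E)`", by the argument
of Cor. 16.3). Given the first clause of `pasten_thm_1_12` (semistable `E/ℚ`:
`∏_{p∣N_E} v_p(Δ_E) < K_ε N_E^{11/2+ε}`), every semistable elliptic curve over `ℚ` satisfies
`Tam(E) < K'_ε N_E^{11/2+ε}`: apply `tamagawaProduct_le_four_pow_mul_prod`,
`exists_four_pow_card_primeFactors_le` with `ε/2`, and Theorem 1.12 with `ε/2`. The named fact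
`pasten_thm_1_12` (Shimura curves, Jacquet–Langlands, Ribet–Takahashi) is the hypothesis `h`; it is
not discharged in the tree. [cite: PastenShimura2024, Theorem 1.15 and Theorem 16.5] -/
theorem pasten_thm_1_15_semistable_of_thm_1_12 (h : pasten_thm_1_12) :
    pasten_thm_1_15_semistable := by
  intro ε hε
  obtain ⟨K₁, hK₁, h₁, -⟩ := h (ε / 2) (half_pos hε)
  obtain ⟨C, hC, hC'⟩ := exists_four_pow_card_primeFactors_le (ε / 2) (half_pos hε)
  refine ⟨C * K₁, mul_pos hC hK₁, fun W _ hW => ?_⟩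
  have hN0 : 0 < W.conductorNorm ℤ := W.conductorNorm_pos_holds
  have hN : (0 : ℝ) < W.conductorNorm ℤ := by exact_mod_cast hN0
  have hT : (W.tamagawaProduct : ℝ) ≤ (4 : ℝ) ^ (W.conductorNorm ℤ).primeFactors.card *
      ((∏ p ∈ (W.conductorNorm ℤ).primeFactors,
        (W.minimalDiscriminantNorm ℤ).factorization p : ℕ) : ℝ) := by
    exact_mod_cast tamagawaProduct_le_four_pow_mul_prod W
  have hP := h₁ W hW
  have h4 := hC' (W.conductorNorm ℤ) hN0.ne'
  calc (W.tamagawaProduct : ℝ)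
      ≤ (4 : ℝ) ^ (W.conductorNorm ℤ).primeFactors.card *
          ((∏ p ∈ (W.conductorNorm ℤ).primeFactors,
            (W.minimalDiscriminantNorm ℤ).factorization p : ℕ) : ℝ) := hT
    _ < (4 : ℝ) ^ (W.conductorNorm ℤ).primeFactors.card *
          (K₁ * (W.conductorNorm ℤ : ℝ) ^ (11 / 2 + ε / 2 : ℝ)) := by gcongr
    _ ≤ (C * (W.conductorNorm ℤ : ℝ) ^ (ε / 2)) *
          (K₁ * (W.conductorNorm ℤ : ℝ) ^ (11 / 2 + ε / 2 : ℝ)) := by gcongr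
    _ = C * K₁ * (W.conductorNorm ℤ : ℝ) ^ (11 / 2 + ε : ℝ) := by
        rw [show (11 / 2 + ε : ℝ) = ε / 2 + (11 / 2 + ε / 2) by ring,
          Real.rpow_add hN (ε / 2) (11 / 2 + ε / 2)]
        ring

/-- **Theorem 1.12, first display ⟹ Theorem 1.15, semistable clause** — the same reduction as
`pasten_thm_1_15_semistable_of_thm_1_12`, from the weakest spelling of the input in the tree:
`DiophantineGeometry.pasten_valuationProduct_semistable` (only the first display
`∏_{p∣N_E} v_p(Δ_E) < K_ε N_E^{11/2+ε}` for semistable `E/ℚ`, `valuationProduct W` being that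
product). `Tam(E) ≤ 4^{ω(N_E)} ∏_{p∣N_E} v_p(Δ_E)` (`tamagawaProduct_le_four_pow_mul_prod`),
`4^{ω(N_E)} ≤ C N_E^{ε/2}` (`exists_four_pow_card_primeFactors_le`) and the input with `ε/2`.
[cite: PastenShimura2024, Theorem 1.15 and Theorem 16.5 (last sentence), via Cor. 16.3 (proof)] -/
theorem pasten_thm_1_15_semistable_of_valuationProduct_semistable
    (h : DiophantineGeometry.pasten_valuationProduct_semistable) :
    pasten_thm_1_15_semistable := by
  intro ε hε
  obtain ⟨K₁, hK₁, h₁⟩ := h (ε / 2) (half_pos hε)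
  obtain ⟨C, hC, hC'⟩ := exists_four_pow_card_primeFactors_le (ε / 2) (half_pos hε)
  refine ⟨C * K₁, mul_pos hC hK₁, fun W _ hW => ?_⟩
  have hN0 : 0 < W.conductorNorm ℤ := W.conductorNorm_pos_holds
  have hN : (0 : ℝ) < W.conductorNorm ℤ := by exact_mod_cast hN0
  have hT : (W.tamagawaProduct : ℝ) ≤ (4 : ℝ) ^ (W.conductorNorm ℤ).primeFactors.card *
      (DiophantineGeometry.valuationProduct W : ℝ) := by
    rw [DiophantineGeometry.valuationProduct_def]
    exact_mod_cast tamagawaProduct_le_four_pow_mul_prod W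
  have hP : (DiophantineGeometry.valuationProduct W : ℝ) <
      K₁ * (W.conductorNorm ℤ : ℝ) ^ ((11 : ℝ) / 2 + ε / 2) := h₁ W hW
  have h4 := hC' (W.conductorNorm ℤ) hN0.ne'
  calc (W.tamagawaProduct : ℝ)
      ≤ (4 : ℝ) ^ (W.conductorNorm ℤ).primeFactors.card *
          (DiophantineGeometry.valuationProduct W : ℝ) := hT
    _ < (4 : ℝ) ^ (W.conductorNorm ℤ).primeFactors.card *
          (K₁ * (W.conductorNorm ℤ : ℝ) ^ ((11 : ℝ) / 2 + ε / 2)) := by gcongr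
    _ ≤ (C * (W.conductorNorm ℤ : ℝ) ^ (ε / 2)) *
          (K₁ * (W.conductorNorm ℤ : ℝ) ^ ((11 : ℝ) / 2 + ε / 2)) := by gcongr
    _ = C * K₁ * (W.conductorNorm ℤ : ℝ) ^ (11 / 2 + ε : ℝ) := by
        rw [show (11 / 2 + ε : ℝ) = ε / 2 + (11 / 2 + ε / 2) by ring,
          Real.rpow_add hN (ε / 2) (11 / 2 + ε / 2)]
        ring

/-- The same reduction from `DiophantineGeometry.pastenShimura2024_thm_1_12` (Theorem 1.12 with
"semi-stable" rendered as `Squarefree N_E`; equivalent to `pasten_valuationProduct_semistable` by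
the tree's `DiophantineGeometry.pasten_valuationProduct_semistable_iff_pastenShimura2024_thm_1_12`,
Silverman ATAEC IV.10.2). [cite: PastenShimura2024, Theorem 1.15 and Theorem 1.12] -/
theorem pasten_thm_1_15_semistable_of_pastenShimura2024_thm_1_12
    (h : DiophantineGeometry.pastenShimura2024_thm_1_12) : pasten_thm_1_15_semistable :=
  pasten_thm_1_15_semistable_of_valuationProduct_semistable
    (DiophantineGeometry.pasten_valuationProduct_semistable_iff_pastenShimura2024_thm_1_12.mpr h)

/-- **Cor. 16.2 + Mestre–Oesterlé ⟹ Theorem 1.15, semistable clause** — the printed chain in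
full: the first part of Theorem 16.5 "follows from Corollary 16.2 with `S = ∅`" after "if
`N_E = p` is prime then `v_p(Δ_E) ≤ 5` (cf. [MestreOesterle])" (the tree's
`pasten_valuationProduct_semistable_of_cor_16_2`), and then "similar estimates hold for `Tam(E)`"
(`pasten_thm_1_15_semistable_of_valuationProduct_semistable`). Both hypotheses are undischarged
named facts of `PastenValuationProduct.lean` (Corollary 16.2 is the Shimura-curve theorem).
[cite: PastenShimura2024, Theorem 16.5 (proof) and Theorem 1.15] -/
theorem pasten_thm_1_15_semistable_of_cor_16_2 (h₁ : pasten_cor_16_2)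
    (h₂ : mestreOesterle_factorization_le_five) : pasten_thm_1_15_semistable :=
  pasten_thm_1_15_semistable_of_valuationProduct_semistable
    (pasten_valuationProduct_semistable_of_cor_16_2 h₁ h₂)

end Rat

end Literature.NumberTheory.EllipticCurves

end
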